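import Literature.Topology.FourManifolds.LongAnnulusAxis
import Literature.Topology.FourManifolds.AxisStraighten
import HarnessLib

/-!
# Flattening a long annulus along its axis

Topic `Literature/Topology/FourManifolds`; sixth infrastructure file of the straightening of a
spanning arc in the proof programme of the Fox–Milnor fact
`Literature.Topology.FourManifolds.Knot.exists_isConnectedSum_isConcordant`. Everything here is
proved; no named fact is introduced.

Input: a long annulus `C` with flat collars at `θ₁` (`FlatAt`, data `x₀, e, σ`), axis
`{x₀} × ℝ` at `θ₁` (`IsAxis`) and constant `θ`-derivative `(σ' θ₁ • e, 0)` along the axis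
(`LongAnnulus.exists_axis_normalised`, `LongAnnulusRotate.lean`). Output
(`LongAnnulus.exists_flatten`): a long annulus `D` of the same width with the same end curves
such that **near `θ₁ + ℤ` the annulus is exactly the level-true flat strip**,
`D.F (θ, s) = (x₀ + σ (θ - m) • e, s)` for `|θ - θ₁ - m| < δ₁`, all `s`, and **body-free near the
axis**: a point of the annulus within distance `r'` of the axis comes from that strip.

Construction (no quantitative perturbation estimates on the surface): thicken the annulus and the
flat strip by the common normal plane `span (N₁, N₂) = e⊥` to maps `Ĉ`, `P̂` from
`(ℝ × ℝ) × (ℝ × ℝ)` to `ℝ³ × ℝ`; both have the same injective derivative at the axis points, so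
`Ĉ` is an injective local diffeomorphism near the axis segment (`exists_isOpen_injOn_of_isCompact`,
`isOpen_image_and_contDiffOn_symm_of_injOn`) and `Φ = P̂ ∘ Ĉ⁻¹` is tangent to the identity along
it; `AxisStraighten.exists_straighten_near_axis` yields the injective immersion
`G = id + κ • (Φ - id)` of `ℝ³ × ℝ`, and `D.F = G ∘ C.F`. Since `C.F` is injective modulo the
period at *all* levels (`LongAnnulus.inj_all`), only parameters near `θ₁ + ℤ` enter the tube where
`κ ≠ 0`, and there `G (C.F (θ, s)) = C.F (θ, s) + κ • (P (θ, s) - C.F (θ, s))` with `P` the flat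
strip: the collars are fixed, the levels move by convex combination (margins), and where `κ = 1`
the annulus *is* the flat strip; the body-free radius comes from injectivity of `G` (which fixes
the axis) and of `C.F`.

## References

* M. W. Hirsch, *Differential Topology*, GTM 33 (1976), Ch. 4 §§5–6 (tubular neighbourhoods),
  Ch. 8 §3. [HirschDT1976]

## Design notes

No named facts, no `sorry`; `𝔼 n` is local notation as in `Knots.lean`.
-/

open scoped Topology ContDiff RealInnerProductSpace
open Function Set Metric Filter

noncomputable section

namespace Literature.Topology.FourManifolds

/-- Local notation: `𝔼 n` is the model Euclidean space `EuclideanSpace ℝ (Fin n)`. -/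
local notation "𝔼 " n:arg => EuclideanSpace ℝ (Fin n)

/-! ### Reduction modulo the period -/

/-- Every real is, modulo `ℤ`, either within `δ` of `θ₁` or represented by a point of
`[θ₁ + δ, θ₁ + 1 - δ]`. [folklore] -/
theorem exists_int_abs_sub_lt_or_mem (θ θ₁ δ : ℝ) :
    (∃ m : ℤ, |θ - θ₁ - m| < δ) ∨
      (θ₁ + Int.fract (θ - θ₁) ∈ Icc (θ₁ + δ) (θ₁ + 1 - δ) ∧
        ∃ m : ℤ, θ = θ₁ + Int.fract (θ - θ₁) + m) := by
  have hf0 := Int.fract_nonneg (θ - θ₁)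
  have hf1 := Int.fract_lt_one (θ - θ₁)
  have hdec : θ = θ₁ + Int.fract (θ - θ₁) + ⌊θ - θ₁⌋ := by
    have := Int.fract_add_floor (θ - θ₁); linarith
  by_cases h1 : Int.fract (θ - θ₁) < δ
  · left
    refine ⟨⌊θ - θ₁⌋, ?_⟩
    rw [show θ - θ₁ - ⌊θ - θ₁⌋ = Int.fract (θ - θ₁) from rfl, abs_of_nonneg hf0]
    exact h1
  by_cases h2 : 1 - δ < Int.fract (θ - θ₁)
  · left
    refine ⟨⌊θ - θ₁⌋ + 1, ?_⟩
    push_cast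
    rw [show θ - θ₁ - (⌊θ - θ₁⌋ + 1) = Int.fract (θ - θ₁) - 1 by rw [Int.fract]; ring,
      abs_of_neg (by linarith)]
    linarith
  · right
    push Not at h1 h2
    exact ⟨⟨by linarith, by linarith⟩, ⌊θ - θ₁⌋, hdec⟩

/-- A convex combination of two points of a closed interval lies in it. [folklore] -/
theorem convex_comb_mem_Icc {lo hi l s k : ℝ} (hl : l ∈ Icc lo hi) (hs : s ∈ Icc lo hi)
    (hk : k ∈ Icc (0 : ℝ) 1) : l + k * (s - l) ∈ Icc lo hi := by
  constructor <;> nlinarith [hl.1, hl.2, hs.1, hs.2, hk.1, hk.2]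

/-- A convex combination of two points of an open interval lies in it. [folklore] -/
theorem convex_comb_mem_Ioo {lo hi l s k : ℝ} (hl : l ∈ Ioo lo hi) (hs : s ∈ Ioo lo hi)
    (hk : k ∈ Icc (0 : ℝ) 1) : l + k * (s - l) ∈ Ioo lo hi := by
  rcases eq_or_lt_of_le hk.2 with h1 | h1
  · rw [h1, one_mul, add_sub_cancel]; exact hs
  · have h2 : 0 < (1 - k) * (l - lo) := mul_pos (by linarith) (by linarith [hl.1])
    have h3 : 0 ≤ k * (s - lo) := mul_nonneg hk.1 (by linarith [hs.1])
    have h4 : 0 < (1 - k) * (hi - l) := mul_pos (by linarith) (by linarith [hl.2])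
    have h5 : 0 ≤ k * (hi - s) := mul_nonneg hk.1 (by linarith [hs.2])
    constructor <;> nlinarith

namespace LongAnnulus

variable {η : ℝ} (A : LongAnnulus η)

/-! ### Injectivity modulo the period at all levels -/

/-- The lower end curve is injective modulo the period. [folklore] -/
theorem k₁_inj {θ θ' : ℝ} (h : A.k₁ θ = A.k₁ θ') : ∃ m : ℤ, θ' = θ + m := by
  have := A.inj (θ, 1) (θ', 1) ⟨le_rfl, by norm_num⟩ ⟨le_rfl, by norm_num⟩
    (by rw [A.collar₁ θ 1 (by linarith [A.η_pos]), A.collar₁ θ' 1 (by linarith [A.η_pos]), h])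
  exact this.2

/-- The upper end curve is injective modulo the period. [folklore] -/
theorem k₂_inj {θ θ' : ℝ} (h : A.k₂ θ = A.k₂ θ') : ∃ m : ℤ, θ' = θ + m := by
  have := A.inj (θ, 2) (θ', 2) ⟨by norm_num, le_rfl⟩ ⟨by norm_num, le_rfl⟩
    (by rw [A.collar₂ θ 2 (by linarith [A.η_pos]), A.collar₂ θ' 2 (by linarith [A.η_pos]), h])
  exact this.2

/-- Off `[1, 2]` the level is the parameter. [folklore] -/
theorem snd_F_of_not_mem {θ s : ℝ} (hs : s ∉ Icc (1 : ℝ) 2) : (A.F (θ, s)).2 = s := by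
  rcases not_and_or.1 hs with h | h
  · exact A.snd_F_of_le (by linarith [A.η_pos, not_le.1 h]) θ
  · exact A.snd_F_of_ge (by linarith [A.η_pos, not_le.1 h]) θ

/-- **A long annulus is injective modulo the period at all levels.** [folklore] -/
theorem inj_all {p q : ℝ × ℝ} (h : A.F p = A.F q) : p.2 = q.2 ∧ ∃ m : ℤ, q.1 = p.1 + m := by
  have hη := A.η_pos
  have hl : (A.F p).2 = (A.F q).2 := by rw [h]
  obtain ⟨θ, s⟩ := p
  obtain ⟨θ', s'⟩ := q
  by_cases hp : s ∈ Icc (1 : ℝ) 2 <;> by_cases hq : s' ∈ Icc (1 : ℝ) 2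
  · exact A.inj (θ, s) (θ', s') hp hq h
  · exfalso
    have h1 := A.snd_F_mem_Icc θ hp
    rw [hl, A.snd_F_of_not_mem hq] at h1
    exact hq h1
  · exfalso
    have h1 := A.snd_F_mem_Icc θ' hq
    rw [← hl, A.snd_F_of_not_mem hp] at h1
    exact hp h1
  · rw [A.snd_F_of_not_mem hp, A.snd_F_of_not_mem hq] at hl
    subst hl
    refine ⟨rfl, ?_⟩
    rcases not_and_or.1 hp with h1 | h1
    · have hs : s ≤ 1 + η := by linarith [not_le.1 h1]
      rw [A.collar₁ θ s hs, A.collar₁ θ' s hs, Prod.mk.injEq] at h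
      exact A.k₁_inj h.1
    · have hs : 2 - η ≤ s := by linarith [not_le.1 h1]
      rw [A.collar₂ θ s hs, A.collar₂ θ' s hs, Prod.mk.injEq] at h
      exact A.k₂_inj h.1

/-! ### Flattening -/

section Flatten

variable {θ₁ ζ : ℝ} {x₀ e : 𝔼 3} {σ : ℝ → ℝ}

/-- The along-coordinate of the lower end curve: a `1`-periodic smooth function equal to
`σ (θ - m)` near `θ₁ + m`. [folklore] -/
def σper (A : LongAnnulus η) (x₀ e : 𝔼 3) (θ : ℝ) : ℝ := ⟪A.k₁ θ - x₀, e⟫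

/-- `σper` is smooth. [folklore] -/
theorem contDiff_σper (x₀ e : 𝔼 3) : ContDiff ℝ ∞ (A.σper x₀ e) :=
  (A.contDiff_k₁.sub contDiff_const).inner ℝ contDiff_const

/-- `σper` is `1`-periodic. [folklore] -/
theorem σper_add_int (x₀ e : 𝔼 3) (θ : ℝ) (m : ℤ) : A.σper x₀ e (θ + m) = A.σper x₀ e θ := by
  have hp : Periodic A.k₁ 1 := A.k₁_add_one
  have := (hp.int_mul m) θ
  simp only [σper, mul_one] at this ⊢
  rw [this]

/-- In the flat window `σper = σ`. [folklore] -/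
theorem σper_eq (hf : A.FlatAt θ₁ ζ x₀ e σ) {θ : ℝ} (hθ : θ ∈ Icc (θ₁ - ζ) (θ₁ + ζ)) :
    A.σper x₀ e θ = σ θ := by
  rw [σper, hf.k₁_eq θ hθ, add_sub_cancel_left, real_inner_smul_left, real_inner_self_eq_norm_sq,
    hf.norm_e]
  ring

/-- Near `θ₁ + m`, `σper θ = σ (θ - m)`. [folklore] -/
theorem σper_eq_sub (hf : A.FlatAt θ₁ ζ x₀ e σ) {θ : ℝ} {m : ℤ} (hθ : |θ - θ₁ - m| ≤ ζ) :
    A.σper x₀ e θ = σ (θ - m) := by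
  rw [abs_le] at hθ
  have h1 : A.σper x₀ e θ = A.σper x₀ e (θ - m) := by
    have := A.σper_add_int x₀ e (θ - m) m
    rw [sub_add_cancel] at this
    exact this
  rw [h1, A.σper_eq hf ⟨by linarith, by linarith⟩]

/-- In the flat window the lower end curve is `x₀ + σper θ • e`. [folklore] -/
theorem k₁_eq_σper (hf : A.FlatAt θ₁ ζ x₀ e σ) {θ : ℝ} {m : ℤ} (hθ : |θ - θ₁ - m| ≤ ζ) :
    A.k₁ θ = x₀ + A.σper x₀ e θ • e := by
  rw [A.σper_eq_sub hf hθ]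
  rw [abs_le] at hθ
  have hp : Periodic A.k₁ 1 := A.k₁_add_one
  have := (hp.int_mul m) (θ - m)
  simp only [mul_one, sub_add_cancel] at this
  rw [this, hf.k₁_eq (θ - m) ⟨by linarith, by linarith⟩]

/-- In the flat window the upper end curve is `x₀ + σper θ • e`. [folklore] -/
theorem k₂_eq_σper (hf : A.FlatAt θ₁ ζ x₀ e σ) {θ : ℝ} {m : ℤ} (hθ : |θ - θ₁ - m| ≤ ζ) :
    A.k₂ θ = x₀ + A.σper x₀ e θ • e := by
  rw [A.σper_eq_sub hf hθ]
  rw [abs_le] at hθ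
  have hp : Periodic A.k₂ 1 := A.k₂_add_one
  have := (hp.int_mul m) (θ - m)
  simp only [mul_one, sub_add_cancel] at this
  rw [this, hf.k₂_eq (θ - m) ⟨by linarith, by linarith⟩]

/-- `σper θ₁ = 0`. [folklore] -/
theorem σper_θ₁ (hf : A.FlatAt θ₁ ζ x₀ e σ) : A.σper x₀ e θ₁ = 0 := by
  rw [A.σper_eq hf hf.θ₁_mem, hf.σ_θ₁]

/-- `σper` and `σ` have the same derivative at `θ₁`. [folklore] -/
theorem deriv_σper (hf : A.FlatAt θ₁ ζ x₀ e σ) : deriv (A.σper x₀ e) θ₁ = deriv σ θ₁ := by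
  apply Filter.EventuallyEq.deriv_eq
  filter_upwards [Ioo_mem_nhds (show θ₁ - ζ < θ₁ by linarith [hf.ζ_pos])
    (show θ₁ < θ₁ + ζ by linarith [hf.ζ_pos])] with θ hθ
  exact A.σper_eq hf (Ioo_subset_Icc_self hθ)

/-- **The differential of the annulus at the axis points**, from its values on `(1, 0)` and
`(0, 1)`. [folklore] -/
theorem fderiv_F_axis (hax : A.IsAxis θ₁ x₀) {w₀ : 𝔼 3}
    (hder : ∀ s, fderiv ℝ A.F (θ₁, s) ((1, 0) : ℝ × ℝ) = ((w₀, 0) : 𝔼 3 × ℝ)) (s : ℝ) :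
    fderiv ℝ A.F (θ₁, s) = (ContinuousLinearMap.fst ℝ ℝ ℝ).smulRight ((w₀, 0) : 𝔼 3 × ℝ) +
      (ContinuousLinearMap.snd ℝ ℝ ℝ).smulRight ((0, 1) : 𝔼 3 × ℝ) := by
  refine ContinuousLinearMap.ext fun v ↦ ?_
  have hv : v = v.1 • ((1, 0) : ℝ × ℝ) + v.2 • ((0, 1) : ℝ × ℝ) := by ext <;> simp
  conv_lhs => rw [hv]
  rw [map_add, map_smul, map_smul, hder s, hax.fderiv_zero_one s]
  simp

/-- **Flattening a long annulus along its axis.** Let `C` have flat collars at `θ₁`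
(`FlatAt θ₁ ζ x₀ e σ`), axis `{x₀} × ℝ` at `θ₁`, and `θ`-derivative `(σ' θ₁ • e, 0)` along the
axis. Then there is a long annulus `D` of the same width with the same end curves, and
`0 < δ₁ ≤ ζ`, `r' > 0`, such that `D.F (θ, s) = (x₀ + σ (θ - m) • e, s)` whenever
`|θ - θ₁ - m| < δ₁` (the level-true flat strip), and every point of `D` within distance `r'` of
the axis (in space) has parameter within `δ₁` of `θ₁ + ℤ`. [folklore] -/
theorem exists_flatten (C : LongAnnulus η) (hf : C.FlatAt θ₁ ζ x₀ e σ) (hax : C.IsAxis θ₁ x₀)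
    (hder : ∀ s, fderiv ℝ C.F (θ₁, s) ((1, 0) : ℝ × ℝ) = ((deriv σ θ₁ • e, 0) : 𝔼 3 × ℝ)) :
    ∃ D : LongAnnulus η, D.k₁ = C.k₁ ∧ D.k₂ = C.k₂ ∧ ∃ δ₁ r' : ℝ, 0 < δ₁ ∧ δ₁ ≤ ζ ∧ 0 < r' ∧
      (∀ θ s (m : ℤ), |θ - θ₁ - m| < δ₁ → D.F (θ, s) = (x₀ + σ (θ - m) • e, s)) ∧
      ∀ θ s, ‖(D.F (θ, s)).1 - x₀‖ < r' → ∃ m : ℤ, |θ - θ₁ - m| < δ₁ := by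
  have hη := C.η_pos
  have hζ := hf.ζ_pos
  set w₀ : 𝔼 3 := deriv σ θ₁ • e with hw₀def
  have hσ' : deriv σ θ₁ ≠ 0 := (hf.deriv_σ_pos θ₁ hf.θ₁_mem).ne'
  have he0 : e ≠ 0 := hf.e_ne_zero
  -- ### the normal frame `e, N₁, N₂`
  obtain ⟨f, hfne⟩ := ArcTube.exists_forall_cr_ne_zero (v := fun _ : ℝ ↦ e) contDiff_const (S := univ)
    (fun _ _ ↦ he0)
  set N₁ : 𝔼 3 := ArcTube.cr e f with hN₁
  set N₂ : 𝔼 3 := ArcTube.cr e N₁ with hN₂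
  have hN₁0 : N₁ ≠ 0 := hfne 0 (mem_univ _)
  have hN₁e : ⟪N₁, e⟫ = 0 := ArcTube.inner_cr_left e f
  have hN₂e : ⟪N₂, e⟫ = 0 := ArcTube.inner_cr_left e N₁
  have hN₂N₁ : ⟪N₂, N₁⟫ = 0 := ArcTube.inner_cr_right e N₁
  have hN₂0 : N₂ ≠ 0 := ArcTube.cr_ne_zero_of_inner_eq_zero he0 hN₁0 (by rw [real_inner_comm]; exact hN₁e)
  -- ### the thickened maps
  set Lin : (ℝ × ℝ) × (ℝ × ℝ) →L[ℝ] 𝔼 3 × ℝ :=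
    ((ContinuousLinearMap.fst ℝ ℝ ℝ).comp (ContinuousLinearMap.snd ℝ (ℝ × ℝ) (ℝ × ℝ))).smulRight
        ((N₁, 0) : 𝔼 3 × ℝ) +
      ((ContinuousLinearMap.snd ℝ ℝ ℝ).comp (ContinuousLinearMap.snd ℝ (ℝ × ℝ) (ℝ × ℝ))).smulRight
        ((N₂, 0) : 𝔼 3 × ℝ) with hLin
  have hLin_apply : ∀ q : (ℝ × ℝ) × (ℝ × ℝ), Lin q = ((q.2.1 • N₁ + q.2.2 • N₂, 0) : 𝔼 3 × ℝ) := by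
    intro q
    simp only [hLin, FunLike.coe_add, Pi.add_apply, ContinuousLinearMap.smulRight_apply,
      ContinuousLinearMap.coe_comp, comp_apply, ContinuousLinearMap.coe_fst', ContinuousLinearMap.coe_snd',
      Prod.smul_mk, smul_zero, Prod.mk_add_mk, add_zero]
  set Chat : (ℝ × ℝ) × (ℝ × ℝ) → 𝔼 3 × ℝ := fun q ↦ C.F q.1 + Lin q with hChat
  set Pper : ℝ × ℝ → 𝔼 3 × ℝ := fun p ↦ (x₀ + C.σper x₀ e p.1 • e, p.2) with hPper
  set Phat : (ℝ × ℝ) × (ℝ × ℝ) → 𝔼 3 × ℝ := fun q ↦ Pper q.1 + Lin q with hPhat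
  have hChat_s : ContDiff ℝ ∞ Chat := (C.contDiff_F.comp contDiff_fst).add Lin.contDiff
  have hPper_s : ContDiff ℝ ∞ Pper :=
    (contDiff_const.add (((C.contDiff_σper x₀ e).comp contDiff_fst).smul contDiff_const)).prodMk contDiff_snd
  have hPhat_s : ContDiff ℝ ∞ Phat := (hPper_s.comp contDiff_fst).add Lin.contDiff
  -- values on the axis
  have hChat_axis : ∀ t, Chat ((θ₁, t), 0) = (x₀, t) := fun t ↦ by
    simp only [hChat, hLin_apply, hax t, Prod.snd_zero, Prod.fst_zero, zero_smul, add_zero]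
    simp
  have hPper_axis : ∀ t, Pper (θ₁, t) = (x₀, t) := fun t ↦ by
    simp only [hPper, C.σper_θ₁ hf, zero_smul, add_zero]
  have hPhat_axis : ∀ t, Phat ((θ₁, t), 0) = (x₀, t) := fun t ↦ by
    simp only [hPhat, hLin_apply, hPper_axis t, Prod.snd_zero, Prod.fst_zero, zero_smul, add_zero]
    simp
  -- ### the common derivative at the axis points
  have hDF := C.fderiv_F_axis hax hder
  set M : (ℝ × ℝ) × (ℝ × ℝ) →L[ℝ] 𝔼 3 × ℝ :=
    ((ContinuousLinearMap.fst ℝ ℝ ℝ).smulRight ((w₀, 0) : 𝔼 3 × ℝ) +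
      (ContinuousLinearMap.snd ℝ ℝ ℝ).smulRight ((0, 1) : 𝔼 3 × ℝ)).comp
        (ContinuousLinearMap.fst ℝ (ℝ × ℝ) (ℝ × ℝ)) + Lin with hM
  have hM_apply : ∀ v : (ℝ × ℝ) × (ℝ × ℝ),
      M v = ((v.1.1 • w₀ + v.2.1 • N₁ + v.2.2 • N₂, v.1.2) : 𝔼 3 × ℝ) := by
    intro v
    simp only [hM, FunLike.coe_add, Pi.add_apply, ContinuousLinearMap.coe_comp, comp_apply,
      ContinuousLinearMap.coe_fst', ContinuousLinearMap.smulRight_apply, ContinuousLinearMap.coe_snd',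
      hLin_apply, Prod.smul_mk, smul_zero, Prod.mk_add_mk, add_zero, zero_add, smul_eq_mul, mul_one,
      mul_zero]
    abel_nf
  have hM_inj : Injective M := by
    refine (injective_iff_map_eq_zero _).2 fun v hv ↦ ?_
    rw [hM_apply, Prod.mk_eq_zero] at hv
    obtain ⟨hv1, hv2⟩ := hv
    have e1 := congrArg (fun x ↦ ⟪x, e⟫) hv1
    have e2 := congrArg (fun x ↦ ⟪x, N₁⟫) hv1
    have e3 := congrArg (fun x ↦ ⟪x, N₂⟫) hv1
    have hw₀e : ⟪w₀, e⟫ = deriv σ θ₁ := by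
      rw [hw₀def, real_inner_smul_left, real_inner_self_eq_norm_sq, hf.norm_e]; ring
    have hw₀N₁ : ⟪w₀, N₁⟫ = 0 := by rw [hw₀def, real_inner_smul_left, real_inner_comm, hN₁e, mul_zero]
    have hw₀N₂ : ⟪w₀, N₂⟫ = 0 := by rw [hw₀def, real_inner_smul_left, real_inner_comm, hN₂e, mul_zero]
    have hN₁N₂ : ⟪N₁, N₂⟫ = 0 := by rw [real_inner_comm]; exact hN₂N₁
    simp only [inner_add_left, real_inner_smul_left, inner_zero_left, hw₀e, hN₁e, hN₂e, hw₀N₁,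
      real_inner_self_eq_norm_sq, hN₂N₁, hw₀N₂, hN₁N₂, mul_zero, add_zero, zero_add] at e1 e2 e3
    have h11 : v.1.1 = 0 := (mul_eq_zero.1 e1).resolve_right hσ'
    have h21 : v.2.1 = 0 := (mul_eq_zero.1 e2).resolve_right (pow_ne_zero _ (norm_ne_zero_iff.2 hN₁0))
    have h22 : v.2.2 = 0 := (mul_eq_zero.1 e3).resolve_right (pow_ne_zero _ (norm_ne_zero_iff.2 hN₂0))
    exact Prod.ext (Prod.ext h11 hv2) (Prod.ext h21 h22)
  -- `DĈ = M = DP̂` at the axis points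
  have hChat_d : ∀ t, HasFDerivAt Chat M ((θ₁, t), 0) := by
    intro t
    have h1 : HasFDerivAt (fun q : (ℝ × ℝ) × (ℝ × ℝ) ↦ C.F q.1)
        ((fderiv ℝ C.F (θ₁, t)).comp (ContinuousLinearMap.fst ℝ (ℝ × ℝ) (ℝ × ℝ))) ((θ₁, t), 0) :=
      HasFDerivAt.comp (((θ₁, t), (0 : ℝ × ℝ)) : (ℝ × ℝ) × (ℝ × ℝ))
        ((C.contDiff_F.differentiable (by simp)) (θ₁, t)).hasFDerivAt
        (hasFDerivAt_fst (𝕜 := ℝ) (E := ℝ × ℝ) (F := ℝ × ℝ))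
    have h := h1.add Lin.hasFDerivAt
    rw [hDF t] at h
    exact h
  have hPper_d : ∀ t, HasFDerivAt Pper (fderiv ℝ C.F (θ₁, t)) (θ₁, t) := by
    intro t
    have hσ0 : HasFDerivAt (fun p : ℝ × ℝ ↦ C.σper x₀ e p.1)
        (((1 : ℝ →L[ℝ] ℝ).smulRight (deriv σ θ₁)).comp (ContinuousLinearMap.fst ℝ ℝ ℝ)) (θ₁, t) := by
      have := HasFDerivAt.comp ((θ₁, t) : ℝ × ℝ)
        (((C.contDiff_σper x₀ e).differentiable (by simp)) θ₁).hasDerivAt.hasFDerivAt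
        (hasFDerivAt_fst (𝕜 := ℝ) (E := ℝ) (F := ℝ))
      rw [C.deriv_σper hf] at this
      exact this
    have h := ((hσ0.smul_const e).const_add x₀).prodMk (hasFDerivAt_snd (p := (θ₁, t)))
    rw [hDF t]
    refine h.congr_fderiv (ContinuousLinearMap.ext fun v ↦ ?_)
    ext1
    · simp [hw₀def, smul_smul]
    · simp
  have hPhat_d : ∀ t, HasFDerivAt Phat M ((θ₁, t), 0) := by
    intro t
    have h1 : HasFDerivAt (fun q : (ℝ × ℝ) × (ℝ × ℝ) ↦ Pper q.1)
        ((fderiv ℝ C.F (θ₁, t)).comp (ContinuousLinearMap.fst ℝ (ℝ × ℝ) (ℝ × ℝ))) ((θ₁, t), 0) :=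
      HasFDerivAt.comp (((θ₁, t), (0 : ℝ × ℝ)) : (ℝ × ℝ) × (ℝ × ℝ)) (hPper_d t)
        (hasFDerivAt_fst (𝕜 := ℝ) (E := ℝ × ℝ) (F := ℝ × ℝ))
    have h := h1.add Lin.hasFDerivAt
    rw [hDF t] at h
    exact h
  -- ### `Ĉ` is an injective local diffeomorphism near the axis segment
  have hdim : Module.finrank ℝ ((ℝ × ℝ) × (ℝ × ℝ)) = Module.finrank ℝ (𝔼 3 × ℝ) := by
    simp [Module.finrank_prod]
  set K₀ : Set ((ℝ × ℝ) × (ℝ × ℝ)) := (({θ₁} : Set ℝ) ×ˢ Icc (-4 : ℝ) 7) ×ˢ {(0 : ℝ × ℝ)} with hK₀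
  have hK₀c : IsCompact K₀ := (isCompact_singleton.prod isCompact_Icc).prod isCompact_singleton
  have hK₀mem : ∀ q ∈ K₀, ∃ t, q = ((θ₁, t), 0) := by
    rintro ⟨⟨a, t⟩, n⟩ hq
    simp only [hK₀, mem_prod, mem_singleton_iff] at hq
    obtain ⟨⟨ha, -⟩, hn⟩ := hq
    exact ⟨t, by rw [ha, hn]⟩
  have hinjK : InjOn Chat K₀ := by
    intro q hq q' hq' heq
    obtain ⟨t, rfl⟩ := hK₀mem q hq
    obtain ⟨t', rfl⟩ := hK₀mem q' hq'
    rw [hChat_axis, hChat_axis, Prod.mk.injEq] at heq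
    rw [heq.2]
  have hderK : ∀ q ∈ K₀, Injective (fderiv ℝ Chat q) := by
    intro q hq
    obtain ⟨t, rfl⟩ := hK₀mem q hq
    rw [(hChat_d t).fderiv]; exact hM_inj
  have hloc : ∀ q ∈ K₀, ∃ U ∈ 𝓝 q, InjOn Chat U := by
    intro q hq
    obtain ⟨L, -, hstrict⟩ := exists_equiv_hasStrictFDerivAt_of_injective hdim hChat_s (hderK q hq)
    exact ⟨(hstrict.toOpenPartialHomeomorph _).source,
      (hstrict.toOpenPartialHomeomorph _).open_source.mem_nhds hstrict.mem_toOpenPartialHomeomorph_source,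
      (hstrict.toOpenPartialHomeomorph _).injOn⟩
  obtain ⟨V₁, hV₁o, hKV₁, hinjV₁⟩ := exists_isOpen_injOn_of_isCompact hK₀c
    (fun q _ ↦ hChat_s.continuous.continuousAt) hinjK hloc
  set V₂ : Set ((ℝ × ℝ) × (ℝ × ℝ)) := V₁ ∩ {q | Injective (fderiv ℝ Chat q)} with hV₂
  have hV₂o : IsOpen V₂ :=
    hV₁o.inter (ContinuousLinearMap.isOpen_injective.preimage (hChat_s.continuous_fderiv (by simp)))
  have hKV₂ : K₀ ⊆ V₂ := fun q hq ↦ ⟨hKV₁ hq, hderK q hq⟩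
  have hinjV₂ : InjOn Chat V₂ := hinjV₁.mono inter_subset_left
  have hderV₂ : ∀ q ∈ V₂, Injective (fderiv ℝ Chat q) := fun q hq ↦ hq.2
  -- a product neighbourhood of the segment inside `V₂`
  obtain ⟨U, W, hUo, hWo, hKU, h0W, hUW⟩ := generalized_tube_lemma (isCompact_singleton.prod isCompact_Icc)
    isCompact_singleton hV₂o hKV₂
  obtain ⟨u₁, v₁, hu₁, hv₁, hθu₁, hIv₁, huv₁⟩ := generalized_tube_lemma isCompact_singleton isCompact_Icc hUo hKU
  obtain ⟨δa, hδa, hballa⟩ := Metric.isOpen_iff.1 hu₁ θ₁ (hθu₁ (mem_singleton θ₁))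
  obtain ⟨δb, hδb, hballb⟩ := Metric.isOpen_iff.1 hWo (0 : ℝ × ℝ) (h0W (mem_singleton _))
  set δ₀ : ℝ := min (min δa δb) (min ζ (1 / 4)) with hδ₀
  have hδ₀pos : 0 < δ₀ := lt_min (lt_min hδa hδb) (lt_min hζ (by norm_num))
  have hδ₀a : δ₀ ≤ δa := (min_le_left _ _).trans (min_le_left _ _)
  have hδ₀b : δ₀ ≤ δb := (min_le_left _ _).trans (min_le_right _ _)
  have hδ₀ζ : δ₀ ≤ ζ := (min_le_right _ _).trans (min_le_left _ _)
  have hδ₀4 : δ₀ ≤ 1 / 4 := (min_le_right _ _).trans (min_le_right _ _)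
  have hQ₀ : ∀ θ s, |θ - θ₁| < δ₀ → s ∈ Icc (-4 : ℝ) 7 → ((θ, s), (0 : ℝ × ℝ)) ∈ V₂ := by
    intro θ s hθ hs
    refine hUW ⟨huv₁ ⟨hballa ?_, hIv₁ hs⟩, hballb (mem_ball_self (hδ₀pos.trans_le hδ₀b))⟩
    rw [mem_ball, dist_eq_norm, Real.norm_eq_abs]; exact hθ.trans_le hδ₀a
  -- ### the local inverse and `Φ`
  obtain ⟨hU₂o, hGinv, hGleft⟩ := isOpen_image_and_contDiffOn_symm_of_injOn hdim hChat_s hV₂o hinjV₂ hderV₂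
  set Ginv := (hinjV₂.toPartialEquiv Chat V₂).symm with hGinvdef
  set U₂ : Set (𝔼 3 × ℝ) := Chat '' V₂ with hU₂
  have hGright : ∀ y ∈ U₂, Chat (Ginv y) = y := fun y hy ↦
    (hinjV₂.toPartialEquiv Chat V₂).right_inv (by rw [hU₂] at hy; exact hy)
  set Φ : 𝔼 3 × ℝ → 𝔼 3 × ℝ := Phat ∘ Ginv with hΦ
  have hΦs : ContDiffOn ℝ ∞ Φ U₂ := hPhat_s.comp_contDiffOn hGinv
  have haxisV₂ : ∀ t ∈ Icc (-4 : ℝ) 7, ((θ₁, t), (0 : ℝ × ℝ)) ∈ V₂ := fun t ht ↦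
    hQ₀ θ₁ t (by simp [hδ₀pos]) ht
  have haxisU₂ : ∀ t ∈ Icc (-4 : ℝ) 7, ((x₀, t) : 𝔼 3 × ℝ) ∈ U₂ := fun t ht ↦
    ⟨((θ₁, t), 0), haxisV₂ t ht, hChat_axis t⟩
  have hGinv_axis : ∀ t ∈ Icc (-4 : ℝ) 7, Ginv (x₀, t) = ((θ₁, t), 0) := fun t ht ↦ by
    rw [← hChat_axis t]; exact hGleft _ (haxisV₂ t ht)
  have hΦid : ∀ t ∈ Icc (-4 : ℝ) 7, Φ (x₀, t) = (x₀, t) := fun t ht ↦ by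
    simp only [hΦ, comp_apply, hGinv_axis t ht, hPhat_axis]
  have hDΦ : ∀ t ∈ Ioo (-4 : ℝ) 7, fderiv ℝ Φ (x₀, t) = ContinuousLinearMap.id ℝ (𝔼 3 × ℝ) := by
    intro t ht
    have ht' : t ∈ Icc (-4 : ℝ) 7 := Ioo_subset_Icc_self ht
    have hy : ((x₀, t) : 𝔼 3 × ℝ) ∈ U₂ := haxisU₂ t ht'
    have hGd : DifferentiableAt ℝ Ginv (x₀, t) := (hGinv.contDiffAt (hU₂o.mem_nhds hy)).differentiableAt (by simp)
    have hq : Ginv (x₀, t) = ((θ₁, t), 0) := hGinv_axis t ht'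
    -- `Ĉ ∘ Ginv = id` near `(x₀, t)`
    have hcomp_id : fderiv ℝ (Chat ∘ Ginv) (x₀, t) = ContinuousLinearMap.id ℝ _ := by
      have hev : Chat ∘ Ginv =ᶠ[𝓝 (x₀, t)] id := by
        filter_upwards [hU₂o.mem_nhds hy] with y hy' using hGright y hy'
      rw [hev.fderiv_eq, fderiv_id]
    have hcomp : fderiv ℝ (Chat ∘ Ginv) (x₀, t) = (fderiv ℝ Chat (Ginv (x₀, t))).comp (fderiv ℝ Ginv (x₀, t)) :=
      fderiv_comp _ ((hChat_s.differentiable (by simp)) _) hGd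
    have hΦcomp : fderiv ℝ Φ (x₀, t) = (fderiv ℝ Phat (Ginv (x₀, t))).comp (fderiv ℝ Ginv (x₀, t)) :=
      fderiv_comp _ ((hPhat_s.differentiable (by simp)) _) hGd
    rw [hΦcomp, hq, (hPhat_d t).fderiv, ← (hChat_d t).fderiv, ← hq, ← hcomp, hcomp_id]
  -- ### separation: only parameters near `θ₁ + ℤ` come close to the axis segment
  set Sfar : Set (ℝ × ℝ) := Icc (θ₁ + δ₀ / 2) (θ₁ + 1 - δ₀ / 2) ×ˢ Icc (-3 : ℝ) 6 with hSfar
  have hSfarc : IsCompact Sfar := isCompact_Icc.prod isCompact_Icc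
  have hnotint : ∀ {θ : ℝ} {m : ℤ}, θ ∈ Icc (θ₁ + δ₀ / 2) (θ₁ + 1 - δ₀ / 2) → θ ≠ θ₁ + m := by
    intro θ m hθ heq
    have h1 : (δ₀ / 2 : ℝ) ≤ m := by have := hθ.1; rw [heq] at this; linarith
    have h2 : (m : ℝ) ≤ 1 - δ₀ / 2 := by have := hθ.2; rw [heq] at this; linarith
    have hm0 : (0 : ℝ) < m := by linarith
    have hm1 : (m : ℝ) < 1 := by linarith
    have : (0 : ℤ) < m := by exact_mod_cast hm0
    have : m < 1 := by exact_mod_cast hm1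
    omega
  obtain ⟨d, hdpos, hd⟩ : ∃ d : ℝ, 0 < d ∧ ∀ t ∈ Icc (-5 / 2 : ℝ) (11 / 2), ∀ p ∈ Sfar,
      d ≤ dist ((x₀, t) : 𝔼 3 × ℝ) (C.F p) := by
    have hKc : IsCompact (Icc (-5 / 2 : ℝ) (11 / 2) ×ˢ Sfar) := isCompact_Icc.prod hSfarc
    have hne : (Icc (-5 / 2 : ℝ) (11 / 2) ×ˢ Sfar).Nonempty :=
      ⟨(0, (θ₁ + 1 / 2, 0)), ⟨⟨by norm_num, by norm_num⟩, ⟨⟨by linarith, by linarith⟩, ⟨by norm_num, by norm_num⟩⟩⟩⟩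
    have hcont : Continuous fun z : ℝ × (ℝ × ℝ) ↦ dist ((x₀, z.1) : 𝔼 3 × ℝ) (C.F z.2) :=
      (continuous_const.prodMk continuous_fst).dist (C.contDiff_F.continuous.comp continuous_snd)
    obtain ⟨z₀, hz₀, hmin⟩ := hKc.exists_isMinOn hne hcont.continuousOn
    rw [isMinOn_iff] at hmin
    have hz₀' := mem_prod.1 hz₀
    refine ⟨dist ((x₀, z₀.1) : 𝔼 3 × ℝ) (C.F z₀.2), ?_, fun t ht p hp ↦ hmin (t, p) (mem_prod.2 ⟨ht, hp⟩)⟩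
    rw [dist_pos]
    intro heq
    have hp := mem_prod.1 hz₀'.2
    obtain ⟨-, m, hm⟩ := C.inj_all (heq.symm.trans (hax z₀.1).symm)
    simp only at hm
    exact (hnotint (m := -m) hp.1 (by rw [hm]; push_cast; ring)).elim
  have hsep : ∀ θ s, s ∈ Icc (-3 : ℝ) 6 → ‖(C.F (θ, s)).1 - x₀‖ < d →
      (C.F (θ, s)).2 ∈ Icc (-5 / 2 : ℝ) (11 / 2) → ∃ m : ℤ, |θ - θ₁ - m| < δ₀ / 2 := by
    intro θ s hs hdist hlev
    rcases exists_int_abs_sub_lt_or_mem θ θ₁ (δ₀ / 2) with h | ⟨hmem, m, hm⟩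
    · exact h
    · exfalso
      set θ' := θ₁ + Int.fract (θ - θ₁) with hθ'
      have hper : C.F (θ, s) = C.F (θ', s) := by
        rw [hm, C.F_add_int]
      have hle := hd _ hlev (θ', s) ⟨hmem, hs⟩
      rw [← hper, Prod.dist_eq, dist_self, dist_eq_norm] at hle
      have : ‖x₀ - (C.F (θ, s)).1‖ < d := by rw [norm_sub_rev]; exact hdist
      have := lt_of_le_of_lt hle (max_lt this hdpos)
      exact lt_irrefl _ this
  -- ### the straightening
  obtain ⟨r, κ, hr, hrd, hTV, hκs, hκmem, hκone, hκsupp, hGs, hGinj, hGder⟩ :=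
    exists_straighten_near_axis x₀ (a := 0) (b := 3) hU₂o
      (fun t ht ↦ haxisU₂ t ⟨by linarith [ht.1], by linarith [ht.2]⟩) hΦs
      (fun t ht ↦ hΦid t ⟨by linarith [ht.1], by linarith [ht.2]⟩)
      (fun t ht ↦ hDΦ t ⟨by linarith [ht.1], by linarith [ht.2]⟩) (r₀ := d / 4) (by positivity)
  set G : 𝔼 3 × ℝ → 𝔼 3 × ℝ := fun y ↦ y + κ y • (Φ y - y) with hG
  -- ### the key formula
  have hkey : ∀ θ s, κ (C.F (θ, s)) ≠ 0 →
      Φ (C.F (θ, s)) = Pper (θ, s) ∧ ∃ m : ℤ, |θ - θ₁ - m| < δ₀ / 2 := by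
    intro θ s hκ0
    obtain ⟨hball, hlev⟩ := hκsupp _ hκ0
    have hlev' : (C.F (θ, s)).2 ∈ Icc (-5 / 2 : ℝ) (11 / 2) :=
      ⟨by linarith [hlev.1], by linarith [hlev.2]⟩
    have hs : s ∈ Icc (-3 : ℝ) 6 := by
      by_cases hsm : s ∈ Icc (1 : ℝ) 2
      · exact ⟨by linarith [hsm.1], by linarith [hsm.2]⟩
      · have := C.snd_F_of_not_mem (θ := θ) hsm
        rw [this] at hlev
        exact ⟨by linarith [hlev.1], by linarith [hlev.2]⟩
    have hdist : ‖(C.F (θ, s)).1 - x₀‖ < d := by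
      rw [mem_ball, dist_eq_norm] at hball; linarith
    obtain ⟨m, hm⟩ := hsep θ s hs hdist hlev'
    refine ⟨?_, m, hm⟩
    have hq : ((θ - m, s), (0 : ℝ × ℝ)) ∈ V₂ := by
      refine hQ₀ (θ - m) s ?_ ⟨by linarith [hs.1], by linarith [hs.2]⟩
      rw [show θ - m - θ₁ = θ - θ₁ - m by ring]; linarith [hδ₀pos]
    have hCq : Chat ((θ - m, s), 0) = C.F (θ, s) := by
      simp only [hChat, hLin_apply, Prod.snd_zero, Prod.fst_zero, zero_smul, add_zero, Prod.mk_zero_zero]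
      have := C.F_add_int (θ - m) s m
      rw [sub_add_cancel] at this
      exact this.symm
    have hGq : Ginv (C.F (θ, s)) = ((θ - m, s), 0) := by rw [← hCq]; exact hGleft _ hq
    simp only [hΦ, comp_apply, hGq, hPhat, hLin_apply, hPper, Prod.snd_zero, Prod.fst_zero, zero_smul,
      add_zero]
    have hσm : C.σper x₀ e (θ - m) = C.σper x₀ e θ := by
      have := C.σper_add_int x₀ e (θ - m) m
      rw [sub_add_cancel] at this
      exact this.symm
    rw [hσm, Prod.mk_zero_zero, add_zero]
  have hF₄ : ∀ θ s, G (C.F (θ, s)) = C.F (θ, s) + κ (C.F (θ, s)) • (Pper (θ, s) - C.F (θ, s)) := by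
    intro θ s
    by_cases h0 : κ (C.F (θ, s)) = 0
    · simp [hG, h0]
    · rw [hG]; simp only; rw [(hkey θ s h0).1]
  -- the level of the new annulus is a convex combination
  have hlevel : ∀ θ s, (G (C.F (θ, s))).2 = (C.F (θ, s)).2 + κ (C.F (θ, s)) * (s - (C.F (θ, s)).2) := by
    intro θ s
    rw [hF₄]
    simp [hPper]
  -- on flat collar points `Pper = C.F`
  have hcoll : ∀ θ s, κ (C.F (θ, s)) ≠ 0 → (s ≤ 1 + η ∨ 2 - η ≤ s) → Pper (θ, s) = C.F (θ, s) := by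
    intro θ s h0 hs
    obtain ⟨-, m, hm⟩ := hkey θ s h0
    have hmζ : |θ - θ₁ - m| ≤ ζ := by linarith [hδ₀ζ]
    rcases hs with hs | hs
    · rw [C.collar₁ θ s hs, hPper, C.k₁_eq_σper hf hmζ]
    · rw [C.collar₂ θ s hs, hPper, C.k₂_eq_σper hf hmζ]
  -- ### the new annulus
  let D : LongAnnulus η :=
    { F := G ∘ C.F
      k₁ := C.k₁
      k₂ := C.k₂
      contDiff_F := hGs.comp C.contDiff_F
      η_pos := C.η_pos
      η_le := C.η_le
      F_add_one := fun θ s ↦ by simp only [comp_apply, C.F_add_one]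
      collar₁ := fun θ s hs ↦ by
        show G (C.F (θ, s)) = (C.k₁ θ, s)
        rw [hF₄]
        by_cases h0 : κ (C.F (θ, s)) = 0
        · rw [h0, zero_smul, add_zero, C.collar₁ θ s hs]
        · rw [hcoll θ s h0 (Or.inl hs), sub_self, smul_zero, add_zero, C.collar₁ θ s hs]
      collar₂ := fun θ s hs ↦ by
        show G (C.F (θ, s)) = (C.k₂ θ, s)
        rw [hF₄]
        by_cases h0 : κ (C.F (θ, s)) = 0
        · rw [h0, zero_smul, add_zero, C.collar₂ θ s hs]
        · rw [hcoll θ s h0 (Or.inr hs), sub_self, smul_zero, add_zero, C.collar₂ θ s hs]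
      margin := fun η' hη' θ s hs ↦ by
        show (G (C.F (θ, s))).2 ∈ _
        rw [hlevel]
        exact convex_comb_mem_Icc (C.margin η' hη' θ s hs) hs (hκmem _)
      margin_Ioo := fun η' hη' θ s hs ↦ by
        show (G (C.F (θ, s))).2 ∈ _
        rw [hlevel]
        exact convex_comb_mem_Ioo (C.margin_Ioo η' hη' θ s hs) hs (hκmem _)
      inj := fun p q hp hq he ↦ C.inj p q hp hq (hGinj he)
      injective_fderiv := fun p hp ↦ by
        show Injective (fderiv ℝ (G ∘ C.F) p)
        rw [fderiv_comp p ((hGs.differentiable (by simp)) _) ((C.contDiff_F.differentiable (by simp)) p)]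
        exact (hGder _).comp (C.injective_fderiv p hp) }
  have hDF' : ∀ θ s, D.F (θ, s) = G (C.F (θ, s)) := fun θ s ↦ rfl
  -- ### the exact strip
  have hO₁ : IsOpen {p : ℝ × ℝ | ‖(C.F p).1 - x₀‖ < r} :=
    isOpen_lt ((continuous_fst.comp C.contDiff_F.continuous).sub continuous_const).norm continuous_const
  have hKO₁ : ({θ₁} : Set ℝ) ×ˢ Icc (-1 : ℝ) 4 ⊆ {p : ℝ × ℝ | ‖(C.F p).1 - x₀‖ < r} := by
    rintro ⟨a, s⟩ ⟨ha, -⟩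
    simp only [mem_singleton_iff] at ha
    show ‖(C.F (a, s)).1 - x₀‖ < r
    rw [ha, hax s]; simpa using hr
  obtain ⟨u₂, v₂, hu₂, -, hθu₂, hIv₂, huv₂⟩ := generalized_tube_lemma isCompact_singleton isCompact_Icc hO₁ hKO₁
  obtain ⟨δc, hδc, hballc⟩ := Metric.isOpen_iff.1 hu₂ θ₁ (hθu₂ (mem_singleton θ₁))
  set δ₁ : ℝ := min δc (δ₀ / 2) with hδ₁
  have hδ₁pos : 0 < δ₁ := lt_min hδc (by positivity)
  have hδ₁c : δ₁ ≤ δc := min_le_left _ _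
  have hδ₁0 : δ₁ ≤ δ₀ / 2 := min_le_right _ _
  have hδ₁ζ : δ₁ ≤ ζ := by linarith [hδ₀ζ]
  have hstrip0 : ∀ θ s, |θ - θ₁| < δ₁ → D.F (θ, s) = (x₀ + σ θ • e, s) := by
    intro θ s hθ
    have hθζ : θ ∈ Icc (θ₁ - ζ) (θ₁ + ζ) := by
      rw [abs_lt] at hθ; exact ⟨by linarith, by linarith⟩
    rw [hDF']
    by_cases hs : s ∈ Icc (-1 : ℝ) 4
    · have hκ1 : κ (C.F (θ, s)) = 1 := by
        refine hκone _ ?_ ?_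
        · have : (θ, s) ∈ {p : ℝ × ℝ | ‖(C.F p).1 - x₀‖ < r} := huv₂ ⟨hballc (by
            rw [mem_ball, dist_eq_norm, Real.norm_eq_abs]; exact hθ.trans_le hδ₁c), hIv₂ hs⟩
          rw [mem_closedBall, dist_eq_norm]; exact le_of_lt this
        · by_cases hsm : s ∈ Icc (1 : ℝ) 2
          · have := C.snd_F_mem_Icc θ hsm
            exact ⟨by linarith [this.1], by linarith [this.2]⟩
          · rw [C.snd_F_of_not_mem hsm]; exact ⟨by linarith [hs.1], by linarith [hs.2]⟩
      rw [hF₄, hκ1, one_smul, add_sub_cancel, hPper]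
      simp only
      rw [C.σper_eq hf hθζ]
    · rcases not_and_or.1 hs with h | h
      · have hs' : s ≤ 1 + η := by linarith [not_le.1 h]
        rw [show G (C.F (θ, s)) = D.F (θ, s) from rfl, D.collar₁ θ s hs']
        show (C.k₁ θ, s) = _
        rw [hf.k₁_eq θ hθζ]
      · have hs' : 2 - η ≤ s := by linarith [not_le.1 h]
        rw [show G (C.F (θ, s)) = D.F (θ, s) from rfl, D.collar₂ θ s hs']
        show (C.k₂ θ, s) = _
        rw [hf.k₂_eq θ hθζ]
  have hstrip : ∀ θ s (m : ℤ), |θ - θ₁ - m| < δ₁ → D.F (θ, s) = (x₀ + σ (θ - m) • e, s) := by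
    intro θ s m hθ
    have := D.F_add_int (θ - m) s m
    rw [sub_add_cancel] at this
    rw [this]
    exact hstrip0 (θ - m) s (by rw [show θ - m - θ₁ = θ - θ₁ - m by ring]; exact hθ)
  -- ### the body-free radius
  have hGaxis : ∀ t, G (x₀, t) = (x₀, t) := by
    intro t
    by_cases h0 : κ (x₀, t) = 0
    · simp [hG, h0]
    · obtain ⟨-, ht⟩ := hκsupp _ h0
      simp only [hG, hΦid t ⟨by linarith [ht.1], by linarith [ht.2]⟩, sub_self, smul_zero, add_zero]
  have hGfst : ∀ y : 𝔼 3 × ℝ, (G y).1 = x₀ → y.1 = x₀ := by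
    intro y hy
    have h1 : G y = G (x₀, (G y).2) := by rw [hGaxis, ← hy]
    have := hGinj h1
    rw [this]
  have hDaxis : ∀ θ s, (D.F (θ, s)).1 = x₀ → ∃ m : ℤ, θ = θ₁ + m := by
    intro θ s h
    rw [hDF'] at h
    have h1 : (C.F (θ, s)).1 = x₀ := hGfst _ h
    have h2 : C.F (θ, s) = C.F (θ₁, (C.F (θ, s)).2) := by
      rw [hax]; ext1; exact h1; rfl
    obtain ⟨-, m, hm⟩ := C.inj_all h2.symm
    exact ⟨m, hm⟩
  have hnotint' : ∀ {θ : ℝ} {m : ℤ}, θ ∈ Icc (θ₁ + δ₁) (θ₁ + 1 - δ₁) → θ ≠ θ₁ + m := by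
    intro θ m hθ heq
    have h1 : (δ₁ : ℝ) ≤ m := by have := hθ.1; rw [heq] at this; linarith
    have h2 : (m : ℝ) ≤ 1 - δ₁ := by have := hθ.2; rw [heq] at this; linarith
    have hm0 : (0 : ℝ) < m := by linarith
    have hm1 : (m : ℝ) < 1 := by linarith
    have : (0 : ℤ) < m := by exact_mod_cast hm0
    have : m < 1 := by exact_mod_cast hm1
    omega
  obtain ⟨r₁, hr₁, hr₁le⟩ : ∃ r₁ : ℝ, 0 < r₁ ∧ ∀ p ∈ Icc (θ₁ + δ₁) (θ₁ + 1 - δ₁) ×ˢ Icc (-2 : ℝ) 5,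
      r₁ ≤ ‖(D.F p).1 - x₀‖ := by
    have hKc : IsCompact (Icc (θ₁ + δ₁) (θ₁ + 1 - δ₁) ×ˢ Icc (-2 : ℝ) 5) := isCompact_Icc.prod isCompact_Icc
    have hne : (Icc (θ₁ + δ₁) (θ₁ + 1 - δ₁) ×ˢ Icc (-2 : ℝ) 5).Nonempty :=
      ⟨(θ₁ + 1 / 2, 0), ⟨⟨by linarith [hδ₀4], by linarith [hδ₀4]⟩, ⟨by norm_num, by norm_num⟩⟩⟩
    have hcont : Continuous fun p : ℝ × ℝ ↦ ‖(D.F p).1 - x₀‖ :=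
      ((continuous_fst.comp D.contDiff_F.continuous).sub continuous_const).norm
    obtain ⟨p₀, hp₀, hmin⟩ := hKc.exists_isMinOn hne hcont.continuousOn
    rw [isMinOn_iff] at hmin
    refine ⟨‖(D.F p₀).1 - x₀‖, ?_, fun p hp ↦ hmin p hp⟩
    rw [norm_pos_iff, sub_ne_zero]
    intro h0
    obtain ⟨m, hm⟩ := hDaxis p₀.1 p₀.2 h0
    exact hnotint' (mem_prod.1 hp₀).1 hm
  obtain ⟨r₂, hr₂, hr₂le⟩ : ∃ r₂ : ℝ, 0 < r₂ ∧ ∀ θ ∈ Icc (θ₁ + δ₁) (θ₁ + 1 - δ₁),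
      r₂ ≤ ‖C.k₁ θ - x₀‖ ∧ r₂ ≤ ‖C.k₂ θ - x₀‖ := by
    have hne : (Icc (θ₁ + δ₁) (θ₁ + 1 - δ₁)).Nonempty := ⟨θ₁ + 1 / 2, ⟨by linarith [hδ₀4], by linarith [hδ₀4]⟩⟩
    have hc₁ : Continuous fun θ ↦ ‖C.k₁ θ - x₀‖ := (C.contDiff_k₁.continuous.sub continuous_const).norm
    have hc₂ : Continuous fun θ ↦ ‖C.k₂ θ - x₀‖ := (C.contDiff_k₂.continuous.sub continuous_const).norm
    obtain ⟨a₁, ha₁, hmin₁⟩ := isCompact_Icc.exists_isMinOn hne hc₁.continuousOn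
    obtain ⟨a₂, ha₂, hmin₂⟩ := isCompact_Icc.exists_isMinOn hne hc₂.continuousOn
    rw [isMinOn_iff] at hmin₁ hmin₂
    have hp₁ : 0 < ‖C.k₁ a₁ - x₀‖ := by
      rw [norm_pos_iff, sub_ne_zero]
      intro h0
      obtain ⟨m, hm⟩ := C.k₁_inj (h0.trans hf.k₁_θ₁.symm)
      exact (hnotint' (m := -m) ha₁ (by rw [hm]; push_cast; ring)).elim
    have hp₂ : 0 < ‖C.k₂ a₂ - x₀‖ := by
      rw [norm_pos_iff, sub_ne_zero]
      intro h0
      obtain ⟨m, hm⟩ := C.k₂_inj (h0.trans hf.k₂_θ₁.symm)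
      exact (hnotint' (m := -m) ha₂ (by rw [hm]; push_cast; ring)).elim
    exact ⟨min ‖C.k₁ a₁ - x₀‖ ‖C.k₂ a₂ - x₀‖, lt_min hp₁ hp₂, fun θ hθ ↦
      ⟨(min_le_left _ _).trans (hmin₁ θ hθ), (min_le_right _ _).trans (hmin₂ θ hθ)⟩⟩
  set r' : ℝ := min r₁ r₂ with hr'
  have hr'pos : 0 < r' := lt_min hr₁ hr₂
  have hbody : ∀ θ s, ‖(D.F (θ, s)).1 - x₀‖ < r' → ∃ m : ℤ, |θ - θ₁ - m| < δ₁ := by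
    intro θ s hdist
    rcases exists_int_abs_sub_lt_or_mem θ θ₁ δ₁ with h | ⟨hmem, m, hm⟩
    · exact h
    · exfalso
      set θ' := θ₁ + Int.fract (θ - θ₁) with hθ'
      have hper : D.F (θ, s) = D.F (θ', s) := by rw [hm, D.F_add_int]
      rw [hper] at hdist
      by_cases hs : s ∈ Icc (-2 : ℝ) 5
      · have := hr₁le (θ', s) ⟨hmem, hs⟩
        linarith [min_le_left r₁ r₂]
      · rcases not_and_or.1 hs with h | h
        · rw [D.collar₁ θ' s (by linarith [not_le.1 h])] at hdist
          have := (hr₂le θ' hmem).1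
          change ‖C.k₁ θ' - x₀‖ < r' at hdist
          linarith [min_le_right r₁ r₂]
        · rw [D.collar₂ θ' s (by linarith [not_le.1 h])] at hdist
          have := (hr₂le θ' hmem).2
          change ‖C.k₂ θ' - x₀‖ < r' at hdist
          linarith [min_le_right r₁ r₂]
  exact ⟨D, rfl, rfl, δ₁, r', hδ₁pos, hδ₁ζ, hr'pos, hstrip, hbody⟩

end Flatten

end LongAnnulus

end Literature.Topology.FourManifolds
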